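import Mathlib
import HarnessLib
import Summits.HubbardSuperconductivity.HubbardSuperconductivity.Theorems.KLProgrammeKLRegimeSplitEdgeFactsRungProfile
import Summits.HubbardSuperconductivity.HubbardSuperconductivity.Theorems.KLProgrammeKLRegimeEngineTwoShellLatticeMass

/-!
# Route `KLProgramme` — ENGINE item stmt-HubbardSuperconductivity-20437 `KLRegimeEngineV17F2`, stub (c) value lane: THE PARTICLE–PARTICLE RUNG MASS AT LARGE
# TOTAL MOMENTUM — the two-shell law for `Σ_c klRungProfile … n ψ Qm c` (cell gate-hubbard-kl, seat hubbard-kl-k3c2-p2 g18, technique «thermal-bar induction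
# n ≤ nScales β + 1 with EngineBounds sums»; part 1 of 2, part 2 = `…PairTransferRungTwoShellBooking`)

WHY.  The class-#5 STEP (in-class total momenta `|p_Qm|_𝕋 ≤ 4^{-(n+1)}`) RESUMS the particle–particle rungs `ḃ_t(Qm,·)` of slice `n+1` (Riccati/Duhamel;
smallness `m·ΣV ≤ 1/3` from the FLAT mass `sum_klRungProfile_compl_le ≤ 738288`).  The OUT-OF-CLASS half of (E2″-F)ₙ (the `hout` rows of
`stepValuesV17F2_of_residue_sameFrame_Q` / `klvrF_outClass_of_sameFrame_frameShift`, this lineage's remaining obligation of stub (c)) does NOT resum: the slice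
increment of the pair amplitude is bounded directly (`klws_increment_of_scaleFlow`: `≤ ∫‖X‖ + m²·∫Σ_c‖ḃ_t(c)‖`), and the pp term must then sit in the slot
`(Klam U)²·G.ppGain (n+1) |p_Qm|_𝕋`, whose large-momentum branch decays like `Λₙ₊₁/|p_Qm|_𝕋 + √Λₙ₊₁` (`klTwoShellProfile`, booked at the token by
`klTSA_twoShell_le_klEngGeo11_ppGain`).  A flat `738288` does not fit that branch.  This file supplies the missing profile — the pp twin of gen 16/17's ph
two-shell rows (`WDd_sum_le_twoShell`, `Wd_member_sum_le_twoShell`) — keyed on row 57's LITERAL rung profile `klRungProfile`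
(`klmf_integral_norm_rate_le_klRungProfile`: `∫₀¹‖ḃ(τ,c)‖dτ ≤ klRungProfile … c`):

* §1 `klBubbleMaj_swap` (`Maj(a,b)(Qm, Qm − c) = Maj(b,a)(Qm, c)`: frequency flip `ν ↦ ν̄` + commutativity), `sum_klBubbleMaj_swap`; the GENERIC two-shell law
  **`sum_klBubbleMaj_le_of_disc_band`**: if `|a| ≤ 1` lives in the disc `ω²+e_K² ≤ Λ′²` and `|b|‖ĝ‖ ≤ B` lives in the band `|e_K| ≤ ε₂`, then
  `Σ_c Maj(a,b)(Qm,c) ≤ (βL²)⁻¹·B·Σ_{ρ(p) ≤ Λ′, |e_K(p_{k̃−Q̃m})| ≤ ε₂} 1/ρ(p)` — inversion symmetry `e_K(p_{Q̃m−c̃}) = e_K(p_{c̃−Q̃m})` (`nambuXiCT_neg`) turns the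
  pp partner `Qm − c` into the two-shell translate of `twoShell_weighted_sum_le`; `…_of_band_disc` (roles swapped, via the swap);
* §2 soft-symbol support (`sq_lt_of_softSymbol_ne_zero`: `0 ≤ φ ≤ 1 − w^K_Λ`, `φ(k) ≠ 0 ⇒ ω²+e_K² < Λ²`; band `|e_K| ≤ 2Λ`; `|φ| ≤ 1`) and
  **`sum_klRungProfile_le_twoShell`**: on an admissible frame with `TwoShellFrameAreaAt A u`, for `0 ≤ ψ + s ≤ 1 − w^K_{Λₙ}` (`s = s^K_{n,n+1}`),
  `2Λₙ + Gδ ≤ klE0` (`G = 4 + (8/3)Gfr₁U²`, `δ = 2π/L`), `0 < r ≤ |p_Qm|_𝕋`: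
  `Σ_c klRungProfile … n ψ Qm c ≤ 3·(βL²)⁻¹·(2/Λₙ₊₁)·W(Λₙ, 2Λₙ, r)`, `W` = `twoShell_weighted_sum_le`'s bound (slice line hard at `n+1`: `s‖ĝ‖ ≤ 2/Λₙ₊₁`);
  closed form **`…_le_twoShell'`** `= (108A/π²)·((2Λₙ+Gδ)/r + √(2Λₙ+Gδ))·((10+2Gβ/L)/π + 12G/(LΛₙ))`; index form `…_compl_le_twoShell'` (`ψ = s^K_{n+1,j}`,
  `n+1 ≤ j`; `j = n+1` is the PLAIN amplitude's running member `ψ = 0`).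
Counting/arithmetic over landed rows; nothing about the model's effective action is asserted; nothing asserts (E2″-F), (c), K3 or superconductivity.  0 kit · 0 lit.
-/

noncomputable section

namespace Summit.HubbardSuperconductivity.HubbardSuperconductivity.Theorems.KLRegimeSplit

set_option linter.dupNamespace false -- summit = problem name (single-conjunct summit), D-0017

open Real Finset Set Literature.MathematicalPhysics.QuantumLattice Literature.Probability.LatticeModels
open Literature.MathematicalPhysics.QuantumLattice.FermiRG
open Summit.HubbardSuperconductivity.HubbardSuperconductivity.Theorems.KLProgrammeLegKernels
open Summit.HubbardSuperconductivity.HubbardSuperconductivity.Theorems.TwoPointAssembly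
open Summit.HubbardSuperconductivity.HubbardSuperconductivity.Theorems.DispersionFlow
open Summit.HubbardSuperconductivity.HubbardSuperconductivity.Theorems.KLRegimeWick
open Summit.HubbardSuperconductivity.HubbardSuperconductivity.Theorems.EngineV8

/-! ## §1 The swap symmetry of the majorant and the generic two-shell law -/

section Generic

variable {L M : ℕ} [NeZero L] (β μ : ℝ) (K : TrigPolyC4v)

omit [NeZero L] in
/-- **Swap symmetry of the pp majorant**: `Maj(a,b)(Qm, Qm − c) = Maj(b,a)(Qm, c)` (reindex the frequency by `ν ↦ ν̄`, then commute the two factors). -/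
theorem klBubbleMaj_swap (a b : FreqMomentum L M → ℝ) (Qm c : TorusSite 2 L) :
    klBubbleMaj L M β μ K a b Qm (Qm - c) = klBubbleMaj L M β μ K b a Qm c := by
  unfold klBubbleMaj
  congr 1
  rw [sub_sub_cancel]
  rw [← Equiv.sum_comp Fin.revPerm (fun ν : MatsubaraIdx M =>
    |b (ν, c)| * ‖propCT L M β μ K (ν, c)‖ * (|a (ν.rev, Qm - c)| * ‖propCT L M β μ K (ν.rev, Qm - c)‖))]
  refine Finset.sum_congr rfl fun ν _ => ?_
  simp only [Fin.revPerm_apply, Fin.rev_rev]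
  ring

/-- Summed form of the swap: `Σ_c Maj(a,b)(Qm,c) = Σ_c Maj(b,a)(Qm,c)` (reindex `c ↦ Qm − c`). -/
theorem sum_klBubbleMaj_swap (a b : FreqMomentum L M → ℝ) (Qm : TorusSite 2 L) :
    ∑ c, klBubbleMaj L M β μ K a b Qm c = ∑ c, klBubbleMaj L M β μ K b a Qm c := by
  rw [← Equiv.sum_comp (Equiv.subLeft Qm) (fun c => klBubbleMaj L M β μ K a b Qm c)]
  exact Finset.sum_congr rfl fun c _ => by rw [Equiv.subLeft_apply, klBubbleMaj_swap]

/-- **GENERIC TWO-SHELL LAW for the majorant, `a` in a disc, `b` in a band**: if `|a| ≤ 1` with `a(k) ≠ 0 ⇒ ω_k² + e_K(k)² ≤ Λ′²`, and `|b(k)|‖ĝ_K(k)‖ ≤ B`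
with `b(k) ≠ 0 ⇒ |e_K(k)| ≤ ε₂`, then `Σ_c Maj(a,b)(Qm,c) ≤ (βL²)⁻¹·B·Σ_{p : ρ(p) ≤ Λ′, |e_K(p_{k̃−Q̃m})| ≤ ε₂} ρ(p)⁻¹`
(the partner momentum `Qm − c` is read through `e_K(p_{Q̃m−c̃}) = e_K(p_{c̃−Q̃m})`). -/
theorem sum_klBubbleMaj_le_of_disc_band (hβ : 0 < β) {a b : FreqMomentum L M → ℝ} {Λ' ε₂ B : ℝ} (ha1 : ∀ k, |a k| ≤ 1)
    (haΛ : ∀ k, a k ≠ 0 → matsubaraFreq β M k.1 ^ 2 + nambuXiCT L μ K k.2 ^ 2 ≤ Λ' ^ 2) (hB : 0 ≤ B)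
    (hbB : ∀ k, |b k| * ‖propCT L M β μ K k‖ ≤ B) (hbε : ∀ k, b k ≠ 0 → |nambuXiCT L μ K k.2| ≤ ε₂) (Qm : TorusSite 2 L) :
    ∑ c, klBubbleMaj L M β μ K a b Qm c ≤ (β * (L : ℝ) ^ 2)⁻¹ * B *
      ∑ p ∈ univ.filter (fun p : FreqMomentum L M => matsubaraFreq β M p.1 ^ 2 + nambuXiCT L μ K p.2 ^ 2 ≤ Λ' ^ 2 ∧ |nambuXiCT L μ K (p.2 - Qm)| ≤ ε₂),
        (Real.sqrt (matsubaraFreq β M p.1 ^ 2 + nambuXiCT L μ K p.2 ^ 2))⁻¹ := by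
  classical
  have hc : 0 ≤ (β * (L : ℝ) ^ 2)⁻¹ := by positivity
  set ind : FreqMomentum L M → ℝ := fun p => if matsubaraFreq β M p.1 ^ 2 + nambuXiCT L μ K p.2 ^ 2 ≤ Λ' ^ 2 ∧ |nambuXiCT L μ K (p.2 - Qm)| ≤ ε₂ then
    (Real.sqrt (matsubaraFreq β M p.1 ^ 2 + nambuXiCT L μ K p.2 ^ 2))⁻¹ else 0 with hind
  have hind0 : ∀ p, 0 ≤ ind p := fun p => by
    simp only [hind]; split_ifs <;> positivity
  -- termwise bound
  have hterm : ∀ (ν : MatsubaraIdx M) (c : TorusSite 2 L),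
      |a (ν, c)| * ‖propCT L M β μ K (ν, c)‖ * (|b (ν.rev, Qm - c)| * ‖propCT L M β μ K (ν.rev, Qm - c)‖) ≤ B * ind (ν, c) := by
    intro ν c
    by_cases ha0 : a (ν, c) = 0
    · rw [ha0, abs_zero, zero_mul, zero_mul]; exact mul_nonneg hB (hind0 _)
    by_cases hb0 : b (ν.rev, Qm - c) = 0
    · rw [hb0, abs_zero, zero_mul, mul_zero]; exact mul_nonneg hB (hind0 _)
    have hdisc := haΛ (ν, c) ha0
    have hband : |nambuXiCT L μ K (c - Qm)| ≤ ε₂ := by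
      have h := hbε (ν.rev, Qm - c) hb0
      rwa [show ((ν.rev, Qm - c) : FreqMomentum L M).2 = -(c - Qm) by simp, nambuXiCT_neg] at h
    have hval : ind (ν, c) = ‖propCT L M β μ K (ν, c)‖ := by
      simp only [hind]
      rw [if_pos ⟨hdisc, hband⟩, norm_propCT_eq]
    rw [hval]
    have hn : 0 ≤ ‖propCT L M β μ K (ν, c)‖ := norm_nonneg _
    calc |a (ν, c)| * ‖propCT L M β μ K (ν, c)‖ * (|b (ν.rev, Qm - c)| * ‖propCT L M β μ K (ν.rev, Qm - c)‖)
        ≤ 1 * ‖propCT L M β μ K (ν, c)‖ * B :=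
          mul_le_mul (mul_le_mul_of_nonneg_right (ha1 _) hn) (hbB _) (mul_nonneg (abs_nonneg _) (norm_nonneg _)) (by positivity)
      _ = B * ‖propCT L M β μ K (ν, c)‖ := by ring
  -- sum
  have hsum : ∑ c, klBubbleMaj L M β μ K a b Qm c ≤ ∑ c : TorusSite 2 L, (β * (L : ℝ) ^ 2)⁻¹ * ∑ ν : MatsubaraIdx M, B * ind (ν, c) := by
    refine Finset.sum_le_sum fun c _ => ?_
    unfold klBubbleMaj
    exact mul_le_mul_of_nonneg_left (Finset.sum_le_sum fun ν _ => hterm ν c) hc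
  refine hsum.trans (le_of_eq ?_)
  have e1 : ∑ c : TorusSite 2 L, (β * (L : ℝ) ^ 2)⁻¹ * ∑ ν : MatsubaraIdx M, B * ind (ν, c) =
      (β * (L : ℝ) ^ 2)⁻¹ * B * ∑ p : FreqMomentum L M, ind p := by
    rw [Fintype.sum_prod_type, Finset.sum_comm]
    simp only [Finset.mul_sum, mul_assoc]
  have e2 : ∑ p : FreqMomentum L M, ind p =
      ∑ p ∈ univ.filter (fun p : FreqMomentum L M => matsubaraFreq β M p.1 ^ 2 + nambuXiCT L μ K p.2 ^ 2 ≤ Λ' ^ 2 ∧ |nambuXiCT L μ K (p.2 - Qm)| ≤ ε₂),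
        (Real.sqrt (matsubaraFreq β M p.1 ^ 2 + nambuXiCT L μ K p.2 ^ 2))⁻¹ := by
    rw [Finset.sum_filter]
  rw [e1, e2]

/-- **Generic two-shell law, roles swapped** (`a` in a band with `|a|‖ĝ‖ ≤ B`, `b` in a disc with `|b| ≤ 1`): same bound (`sum_klBubbleMaj_swap`). -/
theorem sum_klBubbleMaj_le_of_band_disc (hβ : 0 < β) {a b : FreqMomentum L M → ℝ} {Λ' ε₂ B : ℝ} (hb1 : ∀ k, |b k| ≤ 1)
    (hbΛ : ∀ k, b k ≠ 0 → matsubaraFreq β M k.1 ^ 2 + nambuXiCT L μ K k.2 ^ 2 ≤ Λ' ^ 2) (hB : 0 ≤ B)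
    (haB : ∀ k, |a k| * ‖propCT L M β μ K k‖ ≤ B) (haε : ∀ k, a k ≠ 0 → |nambuXiCT L μ K k.2| ≤ ε₂) (Qm : TorusSite 2 L) :
    ∑ c, klBubbleMaj L M β μ K a b Qm c ≤ (β * (L : ℝ) ^ 2)⁻¹ * B *
      ∑ p ∈ univ.filter (fun p : FreqMomentum L M => matsubaraFreq β M p.1 ^ 2 + nambuXiCT L μ K p.2 ^ 2 ≤ Λ' ^ 2 ∧ |nambuXiCT L μ K (p.2 - Qm)| ≤ ε₂),
        (Real.sqrt (matsubaraFreq β M p.1 ^ 2 + nambuXiCT L μ K p.2 ^ 2))⁻¹ := by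
  rw [sum_klBubbleMaj_swap]
  exact sum_klBubbleMaj_le_of_disc_band β μ K hβ hb1 hbΛ hB haB haε Qm

end Generic

/-! ## §2 The rung profile at large total momentum: the two-shell law -/

section Rung

variable {L M : ℕ} [NeZero L] [NeZero M] (β μ : ℝ) (K : TrigPolyC4v)

omit [NeZero L] [NeZero M] in
/-- **Support of a soft symbol**: `0 ≤ φ ≤ 1 − w^K_Λ` and `φ(k) ≠ 0` force `ω_k² + e_K(k)² < Λ²` (`χ₂ = 1` on `[1, ∞)`). -/
theorem sq_lt_of_softSymbol_ne_zero {Λ : ℝ} (hΛ : 0 < Λ) {φ : FreqMomentum L M → ℝ}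
    (hφ : ∀ k, 0 ≤ φ k ∧ φ k ≤ 1 - hubbardCutoffWeightCT L M β μ K Λ k) {k : FreqMomentum L M} (hk : φ k ≠ 0) :
    matsubaraFreq β M k.1 ^ 2 + nambuXiCT L μ K k.2 ^ 2 < Λ ^ 2 := by
  by_contra hge
  push Not at hge
  have hw : hubbardCutoffWeightCT L M β μ K Λ k = 1 := by
    unfold hubbardCutoffWeightCT
    exact salmhoferCutoff_of_ge (by rw [le_div_iff₀ (by positivity)]; linarith)
  have h := hφ k
  rw [hw] at h
  exact hk (le_antisymm (by linarith [h.2]) h.1)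

omit [NeZero L] [NeZero M] in
/-- A soft symbol lives in the disc `ω² + e_K² ≤ Λ²` … -/
theorem sq_le_of_softSymbol_ne_zero {Λ : ℝ} (hΛ : 0 < Λ) {φ : FreqMomentum L M → ℝ}
    (hφ : ∀ k, 0 ≤ φ k ∧ φ k ≤ 1 - hubbardCutoffWeightCT L M β μ K Λ k) (k : FreqMomentum L M) (hk : φ k ≠ 0) :
    matsubaraFreq β M k.1 ^ 2 + nambuXiCT L μ K k.2 ^ 2 ≤ Λ ^ 2 :=
  (sq_lt_of_softSymbol_ne_zero β μ K hΛ hφ hk).le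

omit [NeZero L] [NeZero M] in
/-- … hence in the band `|e_K| ≤ Λ ≤ 2Λ`. -/
theorem abs_nambuXiCT_le_two_mul_of_softSymbol_ne_zero {Λ : ℝ} (hΛ : 0 < Λ) {φ : FreqMomentum L M → ℝ}
    (hφ : ∀ k, 0 ≤ φ k ∧ φ k ≤ 1 - hubbardCutoffWeightCT L M β μ K Λ k) (k : FreqMomentum L M) (hk : φ k ≠ 0) :
    |nambuXiCT L μ K k.2| ≤ 2 * Λ := by
  have h := (abs_le_of_sq_add_sq_le hΛ.le (sq_le_of_softSymbol_ne_zero β μ K hΛ hφ k hk)).2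
  linarith

omit [NeZero L] [NeZero M] in
/-- A soft symbol is bounded by one in absolute value. -/
theorem abs_le_one_of_softSymbol {Λ : ℝ} {φ : FreqMomentum L M → ℝ}
    (hφ : ∀ k, 0 ≤ φ k ∧ φ k ≤ 1 - hubbardCutoffWeightCT L M β μ K Λ k) (k : FreqMomentum L M) : |φ k| ≤ 1 := by
  have h0 : 0 ≤ hubbardCutoffWeightCT L M β μ K Λ k := (salmhoferCutoff_mem_Icc _).1
  rw [abs_of_nonneg (hφ k).1]
  linarith [(hφ k).2]

variable {R : RenConsts} {U : ℝ} {N : ℕ}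

/-- **THE pp RUNG MASS ABOVE THRESHOLD — TWO-SHELL LAW.**  On an admissible frame with a two-shell package `TwoShellFrameAreaAt A u` (`U ≤ u R`), for a history
symbol admissible at `n` (`0 ≤ ψ + s ≤ 1 − w^K_{Λₙ}`, `s = s^K_{n,n+1}`), `2Λₙ + Gδ ≤ klE0` and a torus lower bound `0 < r ≤ |p_Qm|_𝕋` of the TOTAL momentum:
`Σ_c klRungProfile … n ψ Qm c ≤ 3·(βL²)⁻¹·(2/Λₙ₊₁)·W(Λₙ, 2Λₙ, r)` with `W` the bound of `twoShell_weighted_sum_le` (slice line hard at `n+1`: `s‖ĝ‖ ≤ 2/Λₙ₊₁`;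
the three majorants each `≤ (βL²)⁻¹·(2/Λₙ₊₁)·Σ_{ρ ≤ Λₙ, |e_K(p_{k̃−Q̃m})| ≤ 2Λₙ} 1/ρ`). -/
theorem sum_klRungProfile_le_twoShell {A : ℝ} {u : RenConsts → ℝ} (h : TwoShellFrameAreaAt A u) (hA : 0 ≤ A) (hR : R.WF2) (hU : 0 < U)
    (hUu : U ≤ u R) (hμ : μ ∈ klWindowC) (hK : FrameOK R U N μ K) (hβ : 0 < β) (n : ℕ) {ψ : FreqMomentum L M → ℝ}
    (hφ₀ : ∀ k, 0 ≤ ψ k + softSymbolCompl L M β μ K n (n + 1) k ∧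
      ψ k + softSymbolCompl L M β μ K n (n + 1) k ≤ 1 - hubbardCutoffWeightCT L M β μ K (klScale klE0 n) k)
    (hE : 2 * klScale klE0 n + (4 + 8 / 3 * R.Gfr 1 * U ^ 2) * (2 * π / L) ≤ klE0) (Qm : TorusSite 2 L) {r : ℝ} (hr : 0 < r)
    (hrw : r ≤ klTorusNorm L Qm) :
    ∑ c, klRungProfile L M β μ K n ψ Qm c ≤
      3 * ((β * (L : ℝ) ^ 2)⁻¹ * (2 / klScale klE0 (n + 1)) *
        (9 * A * (L : ℝ) ^ 2 / (2 * π ^ 2) *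
          ((2 * klScale klE0 n + (4 + 8 / 3 * R.Gfr 1 * U ^ 2) * (2 * π / L)) / r +
            Real.sqrt (2 * klScale klE0 n + (4 + 8 / 3 * R.Gfr 1 * U ^ 2) * (2 * π / L))) *
          (β * klScale klE0 n / π * (10 + 2 * (4 + 8 / 3 * R.Gfr 1 * U ^ 2) * β / L) + 12 * (4 + 8 / 3 * R.Gfr 1 * U ^ 2) * β / L))) := by
  have hΛ : 0 < klScale klE0 n := klth_klScale_pos n
  have hΛ1 : 0 < klScale klE0 (n + 1) := klth_klScale_pos (n + 1)
  -- the weighted two-shell sum at `(Λ′, ε₂) = (Λₙ, 2Λₙ)`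
  have hW := twoShell_weighted_sum_le (M := M) h hA hR hU hUu hμ hK hβ hΛ (le_refl (2 * klScale klE0 n)) hE Qm hr hrw
  -- the two symbols
  set s : FreqMomentum L M → ℝ := softSymbolCompl L M β μ K n (n + 1) with hs
  set φ₀ : FreqMomentum L M → ℝ := fun k => ψ k + softSymbolCompl L M β μ K n (n + 1) k with hφ₀def
  have hsS : ∀ k, 0 ≤ s k ∧ s k ≤ 1 - hubbardCutoffWeightCT L M β μ K (klScale klE0 n) k :=
    (isSoftSymbol_compl (L := L) (M := M) β μ K (Nat.le_succ n)).1
  have hA_s : ∀ k, |s k| * ‖propCT L M β μ K k‖ ≤ 2 / klScale klE0 (n + 1) := softSymbolCompl_succ_mul_norm_propCT_le (L := L) (M := M) β μ K n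
  have hB : 0 ≤ 2 / klScale klE0 (n + 1) := by positivity
  -- disc / band / size facts
  have hs1 : ∀ k, |s k| ≤ 1 := abs_le_one_of_softSymbol β μ K hsS
  have hφ1 : ∀ k, |φ₀ k| ≤ 1 := abs_le_one_of_softSymbol β μ K hφ₀
  have hsD : ∀ k, s k ≠ 0 → matsubaraFreq β M k.1 ^ 2 + nambuXiCT L μ K k.2 ^ 2 ≤ klScale klE0 n ^ 2 := sq_le_of_softSymbol_ne_zero β μ K hΛ hsS
  have hφD : ∀ k, φ₀ k ≠ 0 → matsubaraFreq β M k.1 ^ 2 + nambuXiCT L μ K k.2 ^ 2 ≤ klScale klE0 n ^ 2 := sq_le_of_softSymbol_ne_zero β μ K hΛ hφ₀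
  have hsE : ∀ k, s k ≠ 0 → |nambuXiCT L μ K k.2| ≤ 2 * klScale klE0 n := abs_nambuXiCT_le_two_mul_of_softSymbol_ne_zero β μ K hΛ hsS
  -- the three majorants
  have t1 := sum_klBubbleMaj_le_of_band_disc β μ K hβ hφ1 hφD hB hA_s hsE Qm
  have t2 := sum_klBubbleMaj_le_of_disc_band β μ K hβ hφ1 hφD hB hA_s hsE Qm
  have t3 := sum_klBubbleMaj_le_of_disc_band β μ K hβ hs1 hsD hB hA_s hsE Qm
  have hc : 0 ≤ (β * (L : ℝ) ^ 2)⁻¹ * (2 / klScale klE0 (n + 1)) := by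
    have : (0 : ℝ) < L := by exact_mod_cast Nat.pos_of_ne_zero (NeZero.ne L)
    positivity
  have u1 := t1.trans (mul_le_mul_of_nonneg_left hW hc)
  have u2 := t2.trans (mul_le_mul_of_nonneg_left hW hc)
  have u3 := t3.trans (mul_le_mul_of_nonneg_left hW hc)
  unfold klRungProfile
  rw [sum_add_distrib, sum_add_distrib]
  simp only [hs, hφ₀def] at u1 u2 u3 ⊢
  linarith

/-- **Closed form** of `sum_klRungProfile_le_twoShell` (`Λₙ₊₁ = Λₙ/4`):
`≤ (108A/π²)·((2Λₙ+Gδ)/r + √(2Λₙ+Gδ))·((10 + 2Gβ/L)/π + 12G/(L·Λₙ))`, `G = 4 + (8/3)Gfr₁U²`, `δ = 2π/L`. -/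
theorem sum_klRungProfile_le_twoShell' {A : ℝ} {u : RenConsts → ℝ} (h : TwoShellFrameAreaAt A u) (hA : 0 ≤ A) (hR : R.WF2) (hU : 0 < U)
    (hUu : U ≤ u R) (hμ : μ ∈ klWindowC) (hK : FrameOK R U N μ K) (hβ : 0 < β) (n : ℕ) {ψ : FreqMomentum L M → ℝ}
    (hφ₀ : ∀ k, 0 ≤ ψ k + softSymbolCompl L M β μ K n (n + 1) k ∧
      ψ k + softSymbolCompl L M β μ K n (n + 1) k ≤ 1 - hubbardCutoffWeightCT L M β μ K (klScale klE0 n) k)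
    (hE : 2 * klScale klE0 n + (4 + 8 / 3 * R.Gfr 1 * U ^ 2) * (2 * π / L) ≤ klE0) (Qm : TorusSite 2 L) {r : ℝ} (hr : 0 < r)
    (hrw : r ≤ klTorusNorm L Qm) :
    ∑ c, klRungProfile L M β μ K n ψ Qm c ≤
      108 * A / π ^ 2 *
        ((2 * klScale klE0 n + (4 + 8 / 3 * R.Gfr 1 * U ^ 2) * (2 * π / L)) / r +
          Real.sqrt (2 * klScale klE0 n + (4 + 8 / 3 * R.Gfr 1 * U ^ 2) * (2 * π / L))) *
        ((10 + 2 * (4 + 8 / 3 * R.Gfr 1 * U ^ 2) * β / L) / π + 12 * (4 + 8 / 3 * R.Gfr 1 * U ^ 2) / (L * klScale klE0 n)) := by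
  refine (sum_klRungProfile_le_twoShell β μ K h hA hR hU hUu hμ hK hβ n hφ₀ hE Qm hr hrw).trans (le_of_eq ?_)
  have hΛ : 0 < klScale klE0 n := klth_klScale_pos n
  have hL : (0 : ℝ) < L := by exact_mod_cast Nat.pos_of_ne_zero (NeZero.ne L)
  have hπ := Real.pi_pos
  rw [klth_klScale_succ n]
  generalize (2 * klScale klE0 n + (4 + 8 / 3 * R.Gfr 1 * U ^ 2) * (2 * π / L)) / r +
    Real.sqrt (2 * klScale klE0 n + (4 + 8 / 3 * R.Gfr 1 * U ^ 2) * (2 * π / L)) = X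
  generalize 4 + 8 / 3 * R.Gfr 1 * U ^ 2 = G
  field_simp
  ring

/-- **Index form** (`ψ = s^K_{n+1,j}`, `n + 1 ≤ j`, so `φ₀ = s^K_{n,j}`; `j = n+1` is the plain amplitude's running member `ψ = 0`). -/
theorem sum_klRungProfile_compl_le_twoShell' {A : ℝ} {u : RenConsts → ℝ} (h : TwoShellFrameAreaAt A u) (hA : 0 ≤ A) (hR : R.WF2) (hU : 0 < U)
    (hUu : U ≤ u R) (hμ : μ ∈ klWindowC) (hK : FrameOK R U N μ K) (hβ : 0 < β) {n j : ℕ} (hj : n + 1 ≤ j)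
    (hE : 2 * klScale klE0 n + (4 + 8 / 3 * R.Gfr 1 * U ^ 2) * (2 * π / L) ≤ klE0) (Qm : TorusSite 2 L) {r : ℝ} (hr : 0 < r)
    (hrw : r ≤ klTorusNorm L Qm) :
    ∑ c, klRungProfile L M β μ K n (softSymbolCompl L M β μ K (n + 1) j) Qm c ≤
      108 * A / π ^ 2 *
        ((2 * klScale klE0 n + (4 + 8 / 3 * R.Gfr 1 * U ^ 2) * (2 * π / L)) / r +
          Real.sqrt (2 * klScale klE0 n + (4 + 8 / 3 * R.Gfr 1 * U ^ 2) * (2 * π / L))) *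
        ((10 + 2 * (4 + 8 / 3 * R.Gfr 1 * U ^ 2) * β / L) / π + 12 * (4 + 8 / 3 * R.Gfr 1 * U ^ 2) / (L * klScale klE0 n)) := by
  refine sum_klRungProfile_le_twoShell' β μ K h hA hR hU hUu hμ hK hβ n (fun k => ?_) hE Qm hr hrw
  have hk := (isSoftSymbol_compl (L := L) (M := M) β μ K ((Nat.le_succ n).trans hj)).1 k
  rw [softSymbolCompl_succ_add_slice_apply β μ K n j k]
  exact hk

end Rung
end Summit.HubbardSuperconductivity.HubbardSuperconductivity.Theorems.KLRegimeSplit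

end
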